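import Summits.CriticalPhenomena.PercolationContinuityZ3.Theorems.SahiMasterFamilyPCDBridge
import Summits.CriticalPhenomena.PercolationContinuityZ3.Theorems.SahiMasterFamilySparseEndLimit
import Summits.CriticalPhenomena.PercolationContinuityZ3.Theorems.SahiMasterFamilyPositiveSomewhereReduction
import Summits.CriticalPhenomena.PercolationContinuityZ3.Theorems.SahiMasterFamilyTerminalPrelim

/-!
# The principal-cap dichotomy, positive form: a principal-cap family outside `Z_k` has `E_k > 0` near the sparse corner

Unit `prim-masterthm-p4` (gen 11; crux anchor stmt-CriticalPhenomena-4575, helper work; memo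
`run/shared/lean/prim/prim-masterthm/prim-masterthm-p4/FACE-QUOTIENT-3.md`).  The tree's principal-cap dichotomy (P4 gens 5–6:
`pcd_holds`, `finSuppZeroFlag_of_principalCap`, bridge `suppZeroFlag_of_principalCap`) says that for `n + 1` increasing non-sure events with
principal common part `⋂ U_j = ↑c`, `E_{n+1} ≡ 0 ⟺ Λ(U) = 0 ⟺ U ∈ Z_{n+1}`; and the sparse-end theorem gives `E_{n+1}(μ_{t𝟙}) = Λ t^{|c|} + …`
with `Λ ≥ 0`.  Putting the two together WITH THE SIGN:

* **`exists_interior_sahiE_pos_of_principalCap`** (every order): a principal-cap family of increasing non-sure events that is NOT a zero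
  flag has `E_{n+1}(μ_p; 1_U) > 0` at some interior `p` (indeed at `p = t𝟙` for all small `t > 0`).
* Hence at order 3 (`PositiveSomewhere.commonPivotalFaceVanishing_of_tight`): the open class statement
  `SahiE3PositiveOfCommonPivotalFaceVanishing` of the (P3+) reduction FOLLOWS from the purely combinatorial
  `FaceVanishingCommonPivotalTight` — "a face-vanishing triple of increasing events with a common pivotal coordinate is TIGHT (every essential
  coordinate lies in the core of some member)" — census-exact on `{0,1}^{≤5}` (74/74 and 291/291 such triples; memo §3).
HONEST FRAMING: the tightness statement, (P3+), Sahi `C_k` / Kahn's Conjecture 5 and the master theorem remain OPEN. [this work]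
-/

noncomputable section

open scoped Classical

namespace Summit.CriticalPhenomena.PercolationContinuityZ3.Theorems

namespace SahiSparseEnd

open Finset Function
open Literature.Combinatorics.Sahi2008
open Literature.Probability.Percolation (DeterminedBy determinedBy_iff)
open Literature.Probability.Percolation.BHK2006 (weight)
open Literature.Probability.Percolation.DecisionTree (ind ind_of_mem ind_of_not_mem)

universe u

variable {ι : Type u} [Fintype ι]

/-- Unit intensities at sparse parameter `t` are intensities `t` at sparse parameter `1`. [folklore] -/
theorem spw_one_eq_spw_const (t : ℝ) : spw (fun _ : ι => (1 : ℝ)) t = spw (fun _ : ι => t) 1 := by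
  funext ω
  simp only [spw, mul_one, one_mul]

/-- **PCD, positive form (every order).**  For `n + 1` increasing events `U_j ⊆ 2^ι`, none of them sure, with principal common part
`⋂ U_j = {S : ↑c ⊆ S}`: if `U` is NOT a zero flag then `E_{n+1}(μ_p; 1_{U_0},…,1_{U_n}) > 0` at some interior `p` (a small constant
parameter vector).  Proof: `Λ(U) ≠ 0` by `finSuppZeroFlag_of_principalCap` + the `Finset`/`Set` bridge, `Λ ≥ 0` always, and `Λ > 0` makes
`E` positive near the sparse corner (`exists_pos_forall_sahiE_spw_pos`). [this work] -/
theorem exists_interior_sahiE_pos_of_principalCap {n : ℕ} (U : Fin (n + 1) → Set (Set ι)) (hU : ∀ j, IsUpperSet (U j))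
    (h0 : ∀ j, (∅ : Set ι) ∉ U j) (c : Finset ι) (hpc : ∀ S : Set ι, (∀ j, S ∈ U j) ↔ (↑c : Set ι) ⊆ S)
    (hZ : ¬ SuppZeroFlag (n + 1) U) :
    ∃ p : ι → unitInterval, (∀ e, (p e : ℝ) ∈ Set.Ioo (0 : ℝ) 1) ∧ 0 < sahiE (bernoulliWeight p) (n + 1) (fun j => ind (U j)) := by
  set V := toFinsetFam U with hVdef
  have hVU : ∀ j (s : Finset ι), s ∈ V j ↔ (↑s : Set ι) ∈ U j := fun j s => mem_toFinsetFam
  have hVup : ∀ j a a', a ∈ V j → a ⊆ a' → a' ∈ V j :=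
    fun j a a' ha haa' => (hVU j a').2 (hU j (Finset.coe_subset.2 haa') ((hVU j a).1 ha))
  have hV0 : ∀ j, ∅ ∉ V j := fun j h => h0 j (by rw [← Finset.coe_empty]; exact (hVU j ∅).1 h)
  have hVpc : IsPrincipalCap V c := by
    intro a
    rw [← Finset.coe_subset, ← hpc]
    exact forall_congr' fun j => hVU j a
  have hne : (common V).Nonempty := ⟨c, hVpc.self_mem_common⟩
  -- `Λ(U) ≠ 0`, hence `> 0`
  have hΛ : LambdaSys (Fc V c) c ≠ 0 := fun h =>
    hZ (suppZeroFlag_of_finSuppZeroFlag (n + 1) V U hVU (finSuppZeroFlag_of_principalCap n V c hVup hV0 hVpc h))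
  have hΛpos : 0 < LambdaSys (Fc V c) c :=
    lt_of_le_of_ne (lambdaSys_Fc_nonneg V hVup hV0 hne (hVpc.mem_commonMin hne)) hΛ.symm
  -- eventual positivity near the sparse corner with unit intensities
  obtain ⟨δ, hδ, hpos⟩ := exists_pos_forall_sahiE_spw_pos V hVup (fun _ => (1 : ℝ)) hne (by
    rw [sparseE_one_zero_of_principalCap V hVup hV0 hVpc hne]; exact Int.cast_pos.2 hΛpos)
  set t : ℝ := min (δ / 2) (1 / 2) with ht
  have ht0 : 0 < t := lt_min (half_pos hδ) (by norm_num)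
  have htδ : t < δ := lt_of_le_of_lt (min_le_left _ _) (half_lt_self hδ)
  have ht1 : t < 1 := lt_of_le_of_lt (min_le_right _ _) (by norm_num)
  have hE := hpos t ht0 htδ
  rw [spw_one_eq_spw_const, hVdef, sahiE_spw_toFinsetFam] at hE
  exact ⟨fun _ => ⟨t, ht0.le, ht1.le⟩, fun _ => ⟨ht0, ht1⟩, hE⟩

end SahiSparseEnd

/-! ### Order 3: the common-pivotal face-vanishing class of (P3+) from TIGHTNESS -/

namespace PositiveSomewhere

open Finset Function
open Literature.Combinatorics.Sahi2008
open Literature.Probability.Percolation (DeterminedBy determinedBy_iff)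
open Literature.Probability.Percolation.DecisionTree (ind ind_of_mem ind_of_not_mem)
open Literature.Probability.LatticeModels.Kahn2022 (Affects)

/-- **Tightness of common-pivotal face-vanishing triples** (OUR CONJECTURE; a statement, never a fact): a triple of increasing events
determined by `S`, all of whose minors at coordinates of `S` are zero flags, with a coordinate pivotal for all three events, has PRINCIPAL
common part generated by a finset `c` — i.e. every coordinate the family depends on lies in the core (every minimal set) of some member.
Census (memo FACE-QUOTIENT-3 §3): all 74 such triples on `{0,1}^4` and all 291 on `{0,1}^5` (exhaustive by gluing) are tight; at each common
pivotal coordinate exactly one member is cored and the other two contractions are support-disjoint. [this work] [status: open; census-exact n ≤ 5] -/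
@[conjecture] def FaceVanishingCommonPivotalTight : Prop :=
  ∀ (ι : Type) [Fintype ι] (U : Fin 3 → Set (Set ι)) (S : Finset ι),
    (∀ j, IsUpperSet (U j)) → (∀ j, DeterminedBy (U j) (↑S : Set ι)) →
      (∃ e : ι, ∀ j, ∃ ω, e ∉ ω ∧ ω ∉ U j ∧ insert e ω ∈ U j) →
        (∀ e ∈ S, ∀ b : Bool, SuppZeroFlag 3 (fun j => secAt e b (U j))) →
          ∃ c : Finset ι, ∀ T : Set ι, (∀ j, T ∈ U j) ↔ (↑c : Set ι) ⊆ T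

/-- A triple with a common pivotal coordinate is not a zero flag (it is pairwise dependent: no two members are determined by disjoint
coordinate sets, since both depend on the common coordinate). [this work] -/
theorem not_suppZeroFlag_three_of_common_pivotal {ι : Type} [Fintype ι] (U : Fin 3 → Set (Set ι)) (hU : ∀ j, IsUpperSet (U j))
    {e : ι} (he : ∀ j, ∃ ω, e ∉ ω ∧ ω ∉ U j ∧ insert e ω ∈ U j) : ¬ SuppZeroFlag 3 U := by
  intro hZ
  obtain ⟨a, b, hab, hd⟩ := exists_disjoint_of_suppZeroFlag_three hU hZ
  have hea : e ∈ esupp (U a) := by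
    obtain ⟨ω, heω, hω, hω'⟩ := he a
    exact mem_esupp.2 ⟨ω, hω, hω'⟩
  have heb : e ∈ esupp (U b) := by
    obtain ⟨ω, heω, hω, hω'⟩ := he b
    exact mem_esupp.2 ⟨ω, hω, hω'⟩
  exact Finset.disjoint_left.1 hd hea heb

/-- A member with a pivotal coordinate is not sure (`∅ ∉ U_j`). [folklore] -/
theorem empty_notMem_of_pivotal {ι : Type} (A : Set (Set ι)) (hA : IsUpperSet A) {e : ι}
    (he : ∃ ω, e ∉ ω ∧ ω ∉ A ∧ insert e ω ∈ A) : (∅ : Set ι) ∉ A := by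
  obtain ⟨ω, -, hω, -⟩ := he
  exact fun h => hω (hA (Set.empty_subset ω) h)

/-- **Tightness ⟹ the common-pivotal face-vanishing class of (P3+).**  If every common-pivotal face-vanishing triple is tight
(`FaceVanishingCommonPivotalTight`), then every such triple has `E_3(μ_p) > 0` at some interior `p` — by the positive form of the
principal-cap dichotomy, since such a triple is never a zero flag. [this work] -/
theorem commonPivotalFaceVanishing_of_tight (hT : FaceVanishingCommonPivotalTight) :
    SahiE3PositiveOfCommonPivotalFaceVanishing := by
  intro ι _ U S hU hUS hpiv hfv
  obtain ⟨c, hc⟩ := hT ι U S hU hUS hpiv hfv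
  obtain ⟨e, he⟩ := hpiv
  exact SahiSparseEnd.exists_interior_sahiE_pos_of_principalCap U hU (fun j => empty_notMem_of_pivotal (U j) (hU j) (he j)) c hc
    (not_suppZeroFlag_three_of_common_pivotal U hU he)

/-- **(P3+) from one combinatorial statement.**  `SahiE3PositiveSomewhere` (a non-zero-flag triple of increasing events has `E_3 > 0`
somewhere in the open cube) follows from the tightness of common-pivotal face-vanishing triples together with positivity on the terminal
class. [this work] -/
theorem sahiE3PositiveSomewhere_of_terminal_of_tight (hterm : SahiE3PositiveOfTerminal) (hT : FaceVanishingCommonPivotalTight) :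
    SahiE3PositiveSomewhere :=
  sahiE3PositiveSomewhere_of_terminal_of_commonPivotal hterm (commonPivotalFaceVanishing_of_tight hT)

end PositiveSomewhere

end Summit.CriticalPhenomena.PercolationContinuityZ3.Theorems
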